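import Summits.NavierStokesRegularity.NavierStokesRegularity.Theorems.ScalingDefectPeepholeDoorSerrinGradientL2
import Literature.Analysis.FluidPDE.NSBootstrapInduction
import HarnessLib

/-!
# ScalingDefectPeepholeDoorSerrinBootstrap — door S30 «ScalingDefectPeepholeDoor», effective plate E0 (step E3a):
# the Serrin bootstrap WITHOUT the pressure — all levels

Sixth file of the pressure-free Serrin chain.  The tree's quantitative bootstrap for bounded
distributional Navier–Stokes solutions (`NSBootstrap.level_zero`, `NSBootstrap.all_levels`; Serrin 1962,
Seregin–Šverák 2009 §2, Lemarié-Rieusset 2016 Thm. 13.1) fixes its constants in terms of `M = ‖u‖_∞`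
AND `P = ‖p‖_{3/2}`, the pressure entering only through the energy-class start
`NSEnergyQuant.exists_weakGradient_energy_bound`.  Here that start is replaced by the pressure-free bound
`Serrin.lintegral_frobeniusNormSq_le` (step E2), and the two theorems are re-assembled VERBATIM from the
tree's pressure-free pieces `NSBootstrap.spin_bound_backward_quant`, `NSBootstrap.basePoisson_of_weakGradient`,
`NSSpinHeatProd.spinHeat_identity_prod` and `NSBootstrap.level_step`:

* `Serrin.levelZero` — level-`0` data with a bound `K₀ = K₀(R, r, M)`;
* `Serrin.allLevels` — level-`n` data on every `C(L', ρ')` strictly inside `C(r₀², r₀)`, `r₀ < R`, with a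
  bound `K = K(n, R, r₀, L', ρ', M)`,

for every distributional solution `(u, p)` on `Q*_R(-R², 0) = ]-2R², 0[ × B(0, R)` with `|u| ≤ M` a.e. and a
weak spatial gradient there (no hypothesis on `p`, none on `∇u`).

Door S30 is a regularity CRITERION inside a HYPOTHETICAL local Type-I blow-up; item 0056 `NoTypeII`
stays OPEN; nothing here bears on NS regularity itself.
-/

noncomputable section

set_option linter.dupNamespace false

namespace Summit.NavierStokesRegularity.NavierStokesRegularity.Theorems.ScalingDefectPeepholeDoor

namespace Serrin

open MeasureTheory Set Function Filter Topology TopologicalSpace Metric InnerProductSpace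
open scoped NNReal ENNReal RealInnerProductSpace Laplacian ContDiff
open Literature.Analysis Literature.Analysis.FluidPDE
open NSBootstrap RepDeriv

/-- The backward cylinders `C(r², r)`, `r ≤ R`, lie in the centred cylinder `Q*_R(-R², 0)`. [folklore] -/
theorem cyl_subset_centered {R r : ℝ} (hr : 0 < r) (hrR : r ≤ R) :
    cyl (r ^ 2) r ⊆ parabolicCylinderCentered R ((-R ^ 2 : ℝ), (0 : EuclideanSpace ℝ (Fin 3))) := by
  intro q hq
  simp only [parabolicCylinderCentered, mem_prod, mem_Ioo, mem_ball] at hq ⊢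
  have h1 : r ^ 2 ≤ R ^ 2 := pow_le_pow_left₀ hr.le hrR 2
  exact ⟨⟨by nlinarith [hq.1.1], by nlinarith [hq.1.2]⟩, lt_of_lt_of_le hq.2 hrR⟩

set_option maxHeartbeats 1600000 in
/-- **Level zero of the bootstrap, pressure-free** (Serrin 1962; Seregin–Šverák 2009, §2 p. 8, `k = 0`,
with the energy-class start replaced by `Serrin.lintegral_frobeniusNormSq_le`). For `0 < r < R` and
`M` there is `K₀ = K₀(R, r, M)` such that every distributional Navier–Stokes solution `(u, p)` on
`Q*_R(-R², 0)` with `|u| ≤ M` a.e. and a weak spatial gradient `G` there has, on `C(r², r)`, the base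
identities `BaseHeat`, `BasePoisson` for `G` and level-`0` data bounded by `K₀`. [folklore] -/
theorem levelZero {R r : ℝ} (hr0 : 0 < r) (hrR : r < R) (M : ℝ) :
    ∃ K₀ : ℝ≥0, ∀ (u : ℝ → EuclideanSpace ℝ (Fin 3) → EuclideanSpace ℝ (Fin 3))
      (p : ℝ → EuclideanSpace ℝ (Fin 3) → ℝ)
      (G : ℝ → EuclideanSpace ℝ (Fin 3) → EuclideanSpace ℝ (Fin 3) →L[ℝ] EuclideanSpace ℝ (Fin 3)),
      IsDistributionalNSSolutionOn
        (parabolicCylinderCenteredOpens R ((-R ^ 2 : ℝ), (0 : EuclideanSpace ℝ (Fin 3)))) 1 0 u p →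
      (∀ᵐ q ∂(volume.restrict
        (parabolicCylinderCentered R ((-R ^ 2 : ℝ), (0 : EuclideanSpace ℝ (Fin 3))))), ‖u q.1 q.2‖ ≤ M) →
      HasWeakSpatialGradientOn
        (parabolicCylinderCenteredOpens R ((-R ^ 2 : ℝ), (0 : EuclideanSpace ℝ (Fin 3)))) u G →
      HasWeakSpatialGradientOn (cylOpens (r ^ 2) r) u G ∧ BaseHeat u G (r ^ 2) r ∧
        BasePoisson u G (r ^ 2) r ∧
        ∃ (U : List (Fin 3) → Fin 3 → ℝ × EuclideanSpace ℝ (Fin 3) → ℝ)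
          (A : List (Fin 3) → Fin 3 → Fin 3 → ℝ × EuclideanSpace ℝ (Fin 3) → ℝ),
          LevelData u G (r ^ 2) r 0 K₀ U A := by
  have hR0 : 0 < R := hr0.trans hrR
  -- an intermediate radius and the constants
  set r' : ℝ := (r + R) / 2 with hr'
  have hrr' : r < r' := by rw [hr']; linarith
  have hr'R : r' < R := by rw [hr']; linarith
  have hr'0 : 0 < r' := hr0.trans hrr'
  obtain ⟨CE, hCE0, hCE⟩ := lintegral_frobeniusNormSq_le hr'0 hr'R
  set B : ℝ≥0 := (CE * (|M| + M ^ 2) ^ 2).toNNReal with hB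
  obtain ⟨KS, hKS0, hKS⟩ := spin_bound_backward_quant hr0 hrr' M B
  set K₀ : ℝ≥0 := (max |M| KS).toNNReal with hK₀
  refine ⟨K₀, fun u p G hsol hbd hG => ?_⟩
  have hKM : |M| ≤ (K₀ : ℝ) := by
    rw [hK₀, Real.coe_toNNReal _ (le_max_of_le_left (abs_nonneg M))]; exact le_max_left _ _
  have hKK : KS ≤ (K₀ : ℝ) := by
    rw [hK₀, Real.coe_toNNReal _ (le_max_of_le_left (abs_nonneg M))]; exact le_max_right _ _
  -- restriction to `C(r'², r')`
  have hsub' : cyl (r' ^ 2) r' ⊆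
      parabolicCylinderCentered R ((-R ^ 2 : ℝ), (0 : EuclideanSpace ℝ (Fin 3))) :=
    cyl_subset_centered hr'0 hr'R.le
  have hle' : cylOpens (r' ^ 2) r' ≤
      parabolicCylinderCenteredOpens R ((-R ^ 2 : ℝ), (0 : EuclideanSpace ℝ (Fin 3))) := hsub'
  have hsub : cyl (r ^ 2) r ⊆ cyl (r' ^ 2) r' := cyl_mono (by nlinarith) hrr'.le
  have hsol' : IsDistributionalNSSolutionOn (cylOpens (r' ^ 2) r') 1 0 u p := hsol.of_le hle'
  have hbd' : ∀ᵐ w ∂(volume.restrict (cyl (r' ^ 2) r')), ‖u w.1 w.2‖ ≤ M :=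
    ae_restrict_of_ae_restrict_of_subset hsub' hbd
  have hG' : HasWeakSpatialGradientOn (cylOpens (r' ^ 2) r') u G := hG.mono hle'
  have hGB : ∫⁻ w in cyl (r' ^ 2) r', ENNReal.ofReal (frobeniusNormSq (G w.1 w.2)) ≤ B := by
    have h := hCE M u p G hsol hbd hG
    have e : (B : ℝ≥0∞) = ENNReal.ofReal (CE * (|M| + M ^ 2) ^ 2) := by
      rw [hB, ENNReal.ofReal]
    rw [e]; exact h
  have hspin := hKS u p G hsol' hbd' hG' hGB
  -- everything on `C(r², r)`
  have hsolr : IsDistributionalNSSolutionOn (cylOpens (r ^ 2) r) 1 0 u p :=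
    hsol'.of_le (cylOpens_mono (by nlinarith) hrr'.le)
  have hbdr : ∀ᵐ w ∂(volume.restrict (cyl (r ^ 2) r)), ‖u w.1 w.2‖ ≤ M :=
    ae_restrict_of_ae_restrict_of_subset hsub hbd'
  have hGr : HasWeakSpatialGradientOn (cylOpens (r ^ 2) r) u G := hG'.mono (cylOpens_mono (by nlinarith) hrr'.le)
  have hG2r : ∫⁻ w in cyl (r ^ 2) r, ENNReal.ofReal (frobeniusNormSq (G w.1 w.2)) < ⊤ :=
    lt_of_le_of_lt ((lintegral_mono_set hsub).trans hGB) ENNReal.coe_lt_top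
  have hur : LocallyIntegrableOn (uncurry u) (cyl (r ^ 2) r) volume := hGr.locallyIntegrableOn
  have hGlr : LocallyIntegrableOn (uncurry G) (cyl (r ^ 2) r) volume := hGr.locallyIntegrableOn_grad
  refine ⟨hGr, fun b c ψ hψ => NSSpinHeatProd.spinHeat_identity_prod hsolr hbdr hGr hG2r b c hψ,
    basePoisson_of_weakGradient (fun θ hθ => hsolr.2.2.2.1 θ hθ) hGr,
    fun _ b q => u q.1 q.2 b, fun _ b c q => spinEntry G b c q, ?_⟩
  intro γ hγ b c
  have hγ0 : γ = [] := List.eq_nil_of_length_eq_zero (Nat.le_zero.1 hγ)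
  subst hγ0
  simp only [List.map_nil]
  have hub : LocallyIntegrableOn (fun q : ℝ × EuclideanSpace ℝ (Fin 3) => u q.1 q.2 b) (cyl (r ^ 2) r) volume :=
    (EuclideanSpace.proj b : EuclideanSpace ℝ (Fin 3) →L[ℝ] ℝ).locallyIntegrableOn_comp hur
  have hAbc : LocallyIntegrableOn (spinEntry G b c) (cyl (r ^ 2) r) volume := by
    have h := (NSSpinHeatProd.locallyIntegrableOn_gradE hGlr b c).sub (NSSpinHeatProd.locallyIntegrableOn_gradE hGlr c b)
    exact h
  refine ⟨isRepDeriv_nil (Q := cylOpens (r ^ 2) r) hub, isRepDeriv_nil (Q := cylOpens (r ^ 2) r) hAbc, ?_, ?_⟩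
  · filter_upwards [hbdr] with q hq
    have h1 : |u q.1 q.2 b| ≤ ‖u q.1 q.2‖ := by
      simpa [Real.norm_eq_abs] using PiLp.norm_apply_le (u q.1 q.2) b
    exact ((h1.trans hq).trans (le_abs_self M)).trans hKM
  · filter_upwards [hspin] with q hq
    exact (hq b c).trans hKK

/-- **All levels of the bootstrap, pressure-free** (Serrin 1962; Seregin–Šverák 2009, §2 p. 8;
Lemarié-Rieusset 2016, Thm. 13.1; the tree's `NSBootstrap.all_levels` with `Serrin.levelZero` as the
start and the pressure-free `NSBootstrap.level_step`). For `n : ℕ`, `0 < r₀ < R`, a cylinder `C(L', ρ')`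
with `0 < L' < r₀²`, `0 < ρ' < r₀`, and `M`, there is `K = K(n, R, r₀, L', ρ', M)` such that every
distributional Navier–Stokes solution `(u, p)` on `Q*_R(-R², 0)` with `|u| ≤ M` a.e. and a weak spatial
gradient `G` there carries, for this `G`, the base identities and level-`n` data bounded by `K` on
`C(L', ρ')`. [folklore] -/
theorem allLevels (n : ℕ) {R r₀ : ℝ} (hr₀ : 0 < r₀) (hr₀R : r₀ < R) (M : ℝ) :
    ∀ {L' ρ' : ℝ}, 0 < L' → L' < r₀ ^ 2 → 0 < ρ' → ρ' < r₀ →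
    ∃ K : ℝ≥0, ∀ (u : ℝ → EuclideanSpace ℝ (Fin 3) → EuclideanSpace ℝ (Fin 3))
      (p : ℝ → EuclideanSpace ℝ (Fin 3) → ℝ)
      (G : ℝ → EuclideanSpace ℝ (Fin 3) → EuclideanSpace ℝ (Fin 3) →L[ℝ] EuclideanSpace ℝ (Fin 3)),
      IsDistributionalNSSolutionOn
        (parabolicCylinderCenteredOpens R ((-R ^ 2 : ℝ), (0 : EuclideanSpace ℝ (Fin 3)))) 1 0 u p →
      (∀ᵐ q ∂(volume.restrict
        (parabolicCylinderCentered R ((-R ^ 2 : ℝ), (0 : EuclideanSpace ℝ (Fin 3))))), ‖u q.1 q.2‖ ≤ M) →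
      HasWeakSpatialGradientOn
        (parabolicCylinderCenteredOpens R ((-R ^ 2 : ℝ), (0 : EuclideanSpace ℝ (Fin 3)))) u G →
      ∃ (U : List (Fin 3) → Fin 3 → ℝ × EuclideanSpace ℝ (Fin 3) → ℝ)
        (A : List (Fin 3) → Fin 3 → Fin 3 → ℝ × EuclideanSpace ℝ (Fin 3) → ℝ),
        HasWeakSpatialGradientOn (cylOpens (r₀ ^ 2) r₀) u G ∧ BaseHeat u G L' ρ' ∧ BasePoisson u G L' ρ' ∧
        LevelData u G L' ρ' n K U A := by
  induction n with
  | zero =>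
    intro L' ρ' hL' hL'r hρ' hρ'r
    obtain ⟨K₀, hK₀⟩ := levelZero hr₀ hr₀R M
    refine ⟨K₀, fun u p G hsol hbd hG => ?_⟩
    obtain ⟨hGr, hheat, hpoi, U, A, hdata⟩ := hK₀ u p G hsol hbd hG
    exact ⟨U, A, hGr, hheat.mono hL'r.le hρ'r.le, hpoi.mono hL'r.le hρ'r.le,
      hdata.mono hL'r.le hρ'r.le le_rfl le_rfl⟩
  | succ n ih =>
    intro L' ρ' hL' hL'r hρ' hρ'r
    -- an intermediate cylinder
    set L'' : ℝ := (L' + r₀ ^ 2) / 2 with hL''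
    set ρ'' : ℝ := (ρ' + r₀) / 2 with hρ''
    have h1 : L' < L'' := by rw [hL'']; linarith
    have h2 : L'' < r₀ ^ 2 := by rw [hL'']; linarith
    have h3 : ρ' < ρ'' := by rw [hρ'']; linarith
    have h4 : ρ'' < r₀ := by rw [hρ'']; linarith
    obtain ⟨Kn, hKn⟩ := ih (hL'.trans h1) h2 (hρ'.trans h3) h4
    obtain ⟨Φ, hΦ⟩ := level_step n hL' h1 hρ' h3
    refine ⟨Φ Kn, fun u p G hsol hbd hG => ?_⟩
    obtain ⟨U, A, hGr, hheat, hpoi, hdata⟩ := hKn u p G hsol hbd hG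
    obtain ⟨U', A', -, hdata'⟩ := hΦ Kn u G U A hheat hpoi hdata
    exact ⟨U', A', hGr, hheat.mono h1.le h3.le, hpoi.mono h1.le h3.le, hdata'⟩

end Serrin

end Summit.NavierStokesRegularity.NavierStokesRegularity.Theorems.ScalingDefectPeepholeDoor

end
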